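import Summits.QuantumFields.YangMills.Theses.SmallCircleAnchor
import Literature.MathematicalPhysics.QuantumFieldTheory.LatticeGaugeStaticPotentialProofs
import Literature.MathematicalPhysics.QuantumFieldTheory.WilsonEnergyConvexity

/-!
# Route `SmallCircleAnchor` — item `EndpointTransfer` (stmt-QuantumFields-11145)

The glue item of the route: the `s = 0` endpoint of Leg B of `AdiabaticContinuity` — volume-uniform
spatial exponential clustering of bounded local observables for the undeformed Wilson theory on the
symmetric torus `ℤ_L × (ℤ/L)³`, written in the route's inline finite-temperature vocabulary (sites
`ZMod L × (Fin 3 → ZMod L)`, links `(site, time | space direction) → G`, weight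
`exp(β Σ_P Re tr r.ρ(U_P))` against product Haar) — implies the `latticeConnectedCorr` clustering
of `UniformLatticeGap` for the representation `r`, with the same rate and `S₁ = 0`.

Proof (as planned in the route file).  Identify the link configurations
`(ZMod L × (Fin 3 → ZMod L)) × Option (Fin 3) → G` with `GaugeConfig 4 L G` through the index
bijection `(y, i) ↦ ((y 3, (y 0, y 1, y 2)), finSuccEquivLast i)` (time = LAST coordinate, so that the
spatial direction `0` of the hypothesis is direction `0 : Fin 4` of `latticeConnectedCorr`; no
coordinate permutation is needed).  Under this reindexing (a measure-preserving equivalence of the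
product Haar measures) `exp(-β · wilsonAction) = const · exp(act)` (the three mixed time/space
plaquette orientations are reversed, which does not change `Re tr ρ`:
`CompactGroup.re_trace_map_inv`), so the normalised expectation `Ex` of the hypothesis is the
`wilsonMeasure r.ρ β` integral (`wilsonExpectation_eq_integral_div`), the spatial translation `σ n`
is `torusConfigShift (-e₀ n)`, and a species `A : YMSpecies G` composed with `torusLift L` is (after
rescaling by its bound) a `Loc` observable for the cube of side `2R` based at `-R`, `R` the sup-norm
radius of `A.supp ∪ B.supp`.  Translation invariance of the torus Wilson state
(`wilsonExpectation_comp_torusConfigShift`) matches the product term, and `n ≤ S ⇒ 2n < 2S+1`.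
-/

open MeasureTheory
open Literature.MathematicalPhysics.QuantumFieldTheory Literature.MathematicalPhysics.QuantumLattice
open Literature.RepresentationTheory.CompactGroups

namespace Summit.QuantumFields.YangMills.Theorems.SmallCircleAnchor

/-- Bookkeeping of the six plaquette orientations at a site of the four-torus, time being the last
coordinate (`finSuccEquivLast`): for a symmetric `P` on ordered pairs of directions with diagonal
value `N`, half the full double sum of `N - P` over `Fin 4 × Fin 4` is the sum over the three
time–space pairs `(none, some a)` plus the sum over the three space–space pairs `a < b`. [folklore] -/
theorem half_sum_fin_four_pairs (N : ℝ) (P : Option (Fin 3) → Option (Fin 3) → ℝ)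
    (hsymm : ∀ μ κ, P μ κ = P κ μ) (hdiag : ∀ μ, P μ μ = N) :
    (1 / 2 : ℝ) * ∑ i : Fin 4, ∑ j : Fin 4, (N - P (finSuccEquivLast i) (finSuccEquivLast j)) =
      (∑ _a : Fin 3, N + ∑ _q : {q : Fin 3 × Fin 3 // q.1 < q.2}, N) -
        (∑ a : Fin 3, P none (some a) +
          ∑ q : {q : Fin 3 × Fin 3 // q.1 < q.2}, P (some q.1.1) (some q.1.2)) := by
  have hinner : ∀ i : Fin 4, ∑ j : Fin 4, (N - P (finSuccEquivLast i) (finSuccEquivLast j)) =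
      ∑ b : Fin 3, (N - P (finSuccEquivLast i) (some b)) + (N - P (finSuccEquivLast i) none) := by
    intro i
    rw [Fin.sum_univ_castSucc]
    simp only [finSuccEquivLast_castSucc, finSuccEquivLast_last]
  simp only [hinner]
  rw [Fin.sum_univ_castSucc]
  simp only [finSuccEquivLast_castSucc, finSuccEquivLast_last, Finset.sum_add_distrib]
  have hhalf := StaticPotential.sum_lt_eq_half_sum (fun a b => N - P (some a) (some b))
    (fun a b => by rw [hsymm]) (fun a => by rw [hdiag, sub_self])
  have h1 : ∑ a : Fin 3, ∑ b : Fin 3, (N - P (some a) (some b)) =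
      2 * ((∑ _q : {q : Fin 3 × Fin 3 // q.1 < q.2}, N) -
        ∑ q : {q : Fin 3 × Fin 3 // q.1 < q.2}, P (some q.1.1) (some q.1.2)) := by
    rw [← Finset.sum_sub_distrib, hhalf]; ring
  have h2 : ∑ a : Fin 3, (N - P (some a) none) = (∑ _a : Fin 3, N) - ∑ a : Fin 3, P none (some a) := by
    rw [← Finset.sum_sub_distrib]
    exact Finset.sum_congr rfl fun a _ => by rw [hsymm]
  have h3 : ∑ b : Fin 3, (N - P none (some b)) = (∑ _a : Fin 3, N) - ∑ a : Fin 3, P none (some a) := by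
    rw [← Finset.sum_sub_distrib]
  have h4 : N - P none none = 0 := by rw [hdiag, sub_self]
  rw [h1, h2, h3, h4]; ring

/-- A residue computation: if `|z| ≤ R` then the residue of `z` lies in the discrete cube of side
`2R` based at `-R`, i.e. `((z mod L) - (-R)).val ≤ 2R`. [folklore] -/
theorem val_intCast_sub_neg_le {L R : ℕ} {z : ℤ} (hz : z.natAbs ≤ R) :
    ((z : ZMod L) - -((R : ℕ) : ZMod L)).val ≤ 2 * R := by
  obtain ⟨k, hk, hkz⟩ : ∃ k : ℕ, k ≤ 2 * R ∧ (k : ℤ) = z + R :=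
    ⟨(z + R).toNat, by omega, by omega⟩
  have h : (z : ZMod L) - -((R : ℕ) : ZMod L) = ((k : ℕ) : ZMod L) := by
    rw [sub_neg_eq_add, ← Int.cast_natCast (R := ZMod L) k, hkz, Int.cast_add, Int.cast_natCast]
  rw [h, ZMod.val_natCast]
  exact (Nat.mod_le _ _).trans hk


/-- **The transfer, at every torus size.** For a faithful unitary lattice representation `r`,
coupling `β` and rate `m`: if for every cube side `w` there is a constant `C(w)` such that the
undeformed Wilson theory on every symmetric torus `ℤ_L × (ℤ/L)³` (inline finite-temperature
vocabulary of route `SmallCircleAnchor`) clusters at rate `m` in the spatial direction `0` for all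
`Loc` observables (verbatim the hypothesis of `EndpointTransfer` at this `β`, `m`), then for all
species `A, B : YMSpecies G` there is `C` with
`|latticeConnectedCorr r.ρ β L A.F B.F n| ≤ C e^{-m n}` for every torus side `L` and all `n` with
`2n < L`. [folklore] -/
theorem endpointTransfer_core {G : Type} [Group G] [TopologicalSpace G] [IsTopologicalGroup G]
    [CompactSpace G] [MeasurableSpace G] [BorelSpace G]
    (r : Literature.MathematicalPhysics.QuantumFieldTheory.LatticeRep G) (β m : ℝ)
    (hw : ∀ w : ℕ, ∃ C : ℝ, ∀ (L : ℕ) [NeZero L], let St := ZMod L × (Fin 3 → ZMod L); let Cfg := St × Option (Fin 3) → G; let ν : MeasureTheory.Measure Cfg := MeasureTheory.Measure.pi fun _ => Literature.MathematicalPhysics.QuantumFieldTheory.haarProbability G; let sh : St → Option (Fin 3) → St := fun x μ => Option.elim μ (x.1 + 1, x.2) fun i => (x.1, x.2 + Pi.single i 1); let pl : Cfg → St → Option (Fin 3) → Option (Fin 3) → G := fun U x μ κ => U (x, μ) * U (sh x μ, κ) * (U (sh x κ, μ))⁻¹ * (U (x, κ))⁻¹; let act : Cfg → ℝ := fun U =>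 β * ∑ x : St, ∑ i : Fin 3, (r.ρ (pl U x none (some i))).trace.re + β * ∑ x : St, ∑ q : {q : Fin 3 × Fin 3 // q.1 < q.2}, (r.ρ (pl U x (some q.1.1) (some q.1.2))).trace.re; let wgt : Cfg → ℝ := fun U => Real.exp (act U); let Ex : (Cfg → ℝ) → ℝ := fun F => (∫ U, F U * wgt U ∂ν) / (∫ U, wgt U ∂ν); let σ : ℕ → Cfg → Cfg := fun n U p => U ((p.1.1, p.1.2 + Pi.single 0 (n : ZMod L)), p.2); ∀ (c : Fin 3 → ZMod L), let Loc := fun F : Cfg → ℝ => Measurable F ∧ (∀ U, |F U| ≤ 1) ∧ ∀ U U', (∀ p, (∀ i : Fin 3, (p.1.2 i - c i).val ≤ w) → U p = U' p) → F U = F U'; ∀ F₁ F₂ : Cfg → ℝ, Loc F₁ → Loc F₂ → ∀ n : ℕ, 2 * n < L → |Ex (fun U => F₁ U * F₂ (σ n U)) - Ex F₁ * Ex (fun U => F₂ (σ n U))| ≤ C * Real.exp (-(m * n)))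
    (A B : Literature.MathematicalPhysics.QuantumFieldTheory.YMSpecies G) :
    ∃ C : ℝ, ∀ (L : ℕ) [NeZero L] (n : ℕ), 2 * n < L →
      |latticeConnectedCorr r.ρ β L A.F B.F n| ≤ C * Real.exp (-(m * n)) := by
  classical
  /- the sup-norm radius of the two supports -/
  obtain ⟨R, hR⟩ : ∃ R : ℕ, ∀ e ∈ A.supp ∪ B.supp, ∀ k : Fin 4, (e.1 k).natAbs ≤ R := by
    refine ⟨(A.supp ∪ B.supp).sup fun e => Finset.univ.sup fun k => (e.1 k).natAbs, ?_⟩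
    intro e he k
    refine le_trans ?_ (Finset.le_sup
      (f := fun e : Literature.MathematicalPhysics.QuantumLattice.ZdEdge 4 => Finset.univ.sup fun k => (e.1 k).natAbs) he)
    exact Finset.le_sup (f := fun k => (e.1 k).natAbs) (Finset.mem_univ k)
  /- bounds of the two species -/
  obtain ⟨CA, hCA⟩ := A.bounded
  obtain ⟨CB, hCB⟩ := B.bounded
  have ha : (0 : ℝ) < max CA 1 := lt_max_of_lt_right one_pos
  have hb : (0 : ℝ) < max CB 1 := lt_max_of_lt_right one_pos
  obtain ⟨C, hC⟩ := hw (2 * R)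
  refine ⟨max CA 1 * max CB 1 * C, fun L _ n hn => ?_⟩
  have key := hC L
  extract_lets St Cfg ν sh pl act wgt Ex σ at key
  have key' := key fun _ => -((R : ℕ) : ZMod L)
  extract_lets Loc at key'
  clear key
  /- the reindexing `(y, i) ↦ ((y 3, init y), finSuccEquivLast i)` of links -/
  let e : Edge 4 L ≃ St × Option (Fin 3) :=
    (Fin.snocEquiv fun _ => ZMod L).symm.prodCongr finSuccEquivLast
  let Ψ : Cfg ≃ᵐ GaugeConfig 4 L G := MeasurableEquiv.arrowCongr' e.symm (MeasurableEquiv.refl G)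
  have hΨ : ∀ (U : Cfg) (p : Edge 4 L), Ψ U p = U (e p) := fun U p => rfl
  have he : ∀ (y : Fin 4 → ZMod L) (k : Fin 4),
      e (y, k) = ((y (Fin.last 3), Fin.init y), finSuccEquivLast k) := fun y k => rfl
  /- arithmetic of the site map -/
  have hinit : ∀ (z : Fin 4 → ZMod L) (k : Fin 3) (c : ZMod L),
      Fin.init (z + Pi.single k.castSucc c) = Fin.init z + Pi.single k c := by
    intro z k c
    funext j
    simp [Fin.init, Pi.single_apply, Fin.castSucc_inj]
  have hlast : ∀ (z : Fin 4 → ZMod L) (k : Fin 3) (c : ZMod L),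
      (z + Pi.single k.castSucc c : Fin 4 → ZMod L) (Fin.last 3) = z (Fin.last 3) := by
    intro z k c
    rw [Pi.add_apply, Pi.single_eq_of_ne (Fin.castSucc_lt_last k).ne', add_zero]
  have hinit' : ∀ (z : Fin 4 → ZMod L) (c : ZMod L),
      Fin.init (z + Pi.single (Fin.last 3) c) = Fin.init z := by
    intro z c
    funext j
    simp only [Fin.init, Pi.add_apply, Pi.single_eq_of_ne (Fin.castSucc_lt_last j).ne, add_zero]
  have hlast' : ∀ (z : Fin 4 → ZMod L) (c : ZMod L),
      (z + Pi.single (Fin.last 3) c : Fin 4 → ZMod L) (Fin.last 3) = z (Fin.last 3) + c := by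
    intro z c
    simp
  have hinit0 : ∀ (z : Fin 4 → ZMod L) (c : ZMod L),
      Fin.init (z + Pi.single (0 : Fin 4) c) = Fin.init z + Pi.single (0 : Fin 3) c :=
    fun z c => hinit z 0 c
  have hlast0 : ∀ (z : Fin 4 → ZMod L) (c : ZMod L),
      (z + Pi.single (0 : Fin 4) c : Fin 4 → ZMod L) (Fin.last 3) = z (Fin.last 3) :=
    fun z c => hlast z 0 c
  have hshift : ∀ (y : Fin 4 → ZMod L) (i : Fin 4),
      ((Literature.MathematicalPhysics.QuantumFieldTheory.Site.shift y i) (Fin.last 3), Fin.init (Literature.MathematicalPhysics.QuantumFieldTheory.Site.shift y i)) =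
        sh (y (Fin.last 3), Fin.init y) (finSuccEquivLast i) := by
    intro y i
    induction i using Fin.lastCases with
    | last =>
      simp only [finSuccEquivLast_last, sh, Option.elim_none, Literature.MathematicalPhysics.QuantumFieldTheory.Site.shift, hinit',
        hlast']
    | cast k =>
      simp only [finSuccEquivLast_castSucc, sh, Option.elim_some, Literature.MathematicalPhysics.QuantumFieldTheory.Site.shift,
        hinit, hlast]
  /- plaquettes -/
  have hhol : ∀ (U : Cfg) (y : Fin 4 → ZMod L) (i j : Fin 4),
      plaquetteHolonomy (Ψ U) y i j =
        pl U (y (Fin.last 3), Fin.init y) (finSuccEquivLast i) (finSuccEquivLast j) := by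
    intro U y i j
    simp only [plaquetteHolonomy, hΨ, he, hshift, pl]
  have hpl_swap : ∀ (U : Cfg) (x : St) (μ κ : Option (Fin 3)), pl U x κ μ = (pl U x μ κ)⁻¹ := by
    intro U x μ κ
    simp only [pl, mul_inv_rev, inv_inv, mul_assoc]
  have hpl_self : ∀ (U : Cfg) (x : St) (μ : Option (Fin 3)), pl U x μ μ = 1 := by
    intro U x μ
    simp only [pl, mul_inv_cancel_right, mul_inv_cancel]
  have hP_symm : ∀ (U : Cfg) (x : St) (μ κ : Option (Fin 3)),
      (r.ρ (pl U x μ κ)).trace.re = (r.ρ (pl U x κ μ)).trace.re := by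
    intro U x μ κ
    rw [hpl_swap U x μ κ, CompactGroup.re_trace_map_inv r.ρ r.continuous]
  have hP_self : ∀ (U : Cfg) (x : St) (μ : Option (Fin 3)),
      (r.ρ (pl U x μ μ)).trace.re = r.N := by
    intro U x μ
    rw [hpl_self, map_one, Matrix.trace_one]
    simp
  /- the action transfer: `-β · S_W ∘ Ψ = const + act` -/
  have hS : ∀ U : Cfg, wilsonAction r.ρ (Ψ U) =
      ∑ x : St, ((∑ _a : Fin 3, (r.N : ℝ) + ∑ _q : {q : Fin 3 × Fin 3 // q.1 < q.2}, (r.N : ℝ)) -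
        (∑ a : Fin 3, (r.ρ (pl U x none (some a))).trace.re +
          ∑ q : {q : Fin 3 × Fin 3 // q.1 < q.2}, (r.ρ (pl U x (some q.1.1) (some q.1.2))).trace.re)) := by
    intro U
    rw [wilsonAction_eq_half_sum r.ρ r.continuous]
    simp only [hhol]
    exact Fintype.sum_equiv (Fin.snocEquiv fun _ => ZMod L).symm _ _ fun y =>
      half_sum_fin_four_pairs (r.N : ℝ) (fun μ κ => (r.ρ (pl U (y (Fin.last 3), Fin.init y) μ κ)).trace.re)
        (hP_symm U _) (hP_self U _)
  have hact : ∀ U : Cfg, -β * wilsonAction r.ρ (Ψ U) =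
      -β * (∑ _x : St, ((∑ _a : Fin 3, (r.N : ℝ) + ∑ _q : {q : Fin 3 × Fin 3 // q.1 < q.2}, (r.N : ℝ))))
        + act U := by
    intro U
    rw [hS]
    simp only [Finset.sum_sub_distrib, Finset.sum_add_distrib, act]
    ring
  have hexp : ∀ U : Cfg, Real.exp (-β * wilsonAction r.ρ (Ψ U)) =
      Real.exp (-β * (∑ _x : St, ((∑ _a : Fin 3, (r.N : ℝ) +
        ∑ _q : {q : Fin 3 × Fin 3 // q.1 < q.2}, (r.N : ℝ))))) * wgt U := by
    intro U
    rw [hact, Real.exp_add]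
  /- the expectation transfer: `Ex (X ∘ Ψ) = ∫ X dμ_W` -/
  have hEx : ∀ X : GaugeConfig 4 L G → ℝ,
      Ex (fun U => X (Ψ U)) = ∫ V, X V ∂(wilsonMeasure r.ρ β) := by
    intro X
    have h := wilsonExpectation_eq_integral_div (d := 4) (L := L) r.ρ r.continuous β X
    unfold wilsonExpectation at h
    have hmp : MeasurePreserving Ψ ν (Measure.pi fun _ : Edge 4 L => haarProbability G) :=
      measurePreserving_arrowCongr' (fun _ => haarProbability G) (fun _ => haarProbability G)
        e.symm (MeasurableEquiv.refl G) fun _ => MeasurePreserving.id _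
    have hmap : Measure.map Ψ ν = Measure.pi fun _ : Edge 4 L => haarProbability G := hmp.map_eq
    rw [h, ← hmap, integral_map_equiv, integral_map_equiv]
    simp only [hexp]
    have hnum : ∫ U, X (Ψ U) * (Real.exp (-β * (∑ _x : St, ((∑ _a : Fin 3, (r.N : ℝ) +
        ∑ _q : {q : Fin 3 × Fin 3 // q.1 < q.2}, (r.N : ℝ))))) * wgt U) ∂ν =
        Real.exp (-β * (∑ _x : St, ((∑ _a : Fin 3, (r.N : ℝ) +
          ∑ _q : {q : Fin 3 × Fin 3 // q.1 < q.2}, (r.N : ℝ))))) * ∫ U, X (Ψ U) * wgt U ∂ν := by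
      rw [← integral_const_mul]
      congr 1
      funext U
      ring
    rw [hnum, integral_const_mul, mul_div_mul_left _ _ (Real.exp_pos _).ne']
  /- the spatial translation `σ n` is the torus translation by `-n e₀` -/
  have hσ : ∀ U : Cfg, Ψ (σ n U) = torusConfigShift (-Pi.single 0 (n : ZMod L)) (Ψ U) := by
    intro U
    funext p
    obtain ⟨z, k⟩ := p
    rw [torusConfigShift_apply]
    simp only [hΨ, he, σ, sub_neg_eq_add]
    rw [hinit0 z (n : ZMod L), hlast0 z (n : ZMod L)]
  /- the two observables -/
  have hXA : ∀ (U : Cfg), |(max CA 1)⁻¹ * A.F (torusLift L (Ψ U))| ≤ 1 := fun U => by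
    rw [abs_mul, abs_of_pos (inv_pos.2 ha)]
    calc (max CA 1)⁻¹ * |A.F (torusLift L (Ψ U))| ≤ (max CA 1)⁻¹ * max CA 1 :=
          mul_le_mul_of_nonneg_left ((hCA _).trans (le_max_left _ _)) (inv_pos.2 ha).le
      _ = 1 := inv_mul_cancel₀ ha.ne'
  have hXB : ∀ (U : Cfg), |(max CB 1)⁻¹ * B.F (torusLift L (Ψ U))| ≤ 1 := fun U => by
    rw [abs_mul, abs_of_pos (inv_pos.2 hb)]
    calc (max CB 1)⁻¹ * |B.F (torusLift L (Ψ U))| ≤ (max CB 1)⁻¹ * max CB 1 :=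
          mul_le_mul_of_nonneg_left ((hCB _).trans (le_max_left _ _)) (inv_pos.2 hb).le
      _ = 1 := inv_mul_cancel₀ hb.ne'
  have hdep : ∀ (O : YMSpecies G), (∀ e ∈ O.supp, ∀ k : Fin 4, (e.1 k).natAbs ≤ R) →
      ∀ (a : ℝ) (U U' : Cfg), (∀ p, (∀ i : Fin 3, (p.1.2 i - -((R : ℕ) : ZMod L)).val ≤ 2 * R) →
        U p = U' p) → a * O.F (torusLift L (Ψ U)) = a * O.F (torusLift L (Ψ U')) := by
    intro O hO a U U' hUU'
    congr 1
    apply O.isCylinder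
    intro d hd
    show Ψ U (torusEdge L d) = Ψ U' (torusEdge L d)
    rw [hΨ, hΨ]
    apply hUU'
    intro i
    exact val_intCast_sub_neg_le (hO d (Finset.mem_coe.1 hd) (Fin.castSucc i))
  have hLA : Loc (fun U => (max CA 1)⁻¹ * A.F (torusLift L (Ψ U))) :=
    ⟨(A.measurable.comp ((measurable_torusLift (d := 4) L).comp Ψ.measurable)).const_mul _, hXA,
      hdep A (fun d hd => hR d (Finset.mem_union_left _ hd)) _⟩
  have hLB : Loc (fun U => (max CB 1)⁻¹ * B.F (torusLift L (Ψ U))) :=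
    ⟨(B.measurable.comp ((measurable_torusLift (d := 4) L).comp Ψ.measurable)).const_mul _, hXB,
      hdep B (fun d hd => hR d (Finset.mem_union_right _ hd)) _⟩
  /- the clustering hypothesis for them -/
  have main : |Ex (fun U => (max CA 1)⁻¹ * A.F (torusLift L (Ψ U)) *
      ((max CB 1)⁻¹ * B.F (torusLift L (Ψ (σ n U))))) -
        Ex (fun U => (max CA 1)⁻¹ * A.F (torusLift L (Ψ U))) *
          Ex (fun U => (max CB 1)⁻¹ * B.F (torusLift L (Ψ (σ n U))))| ≤ C * Real.exp (-(m * n)) :=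
    key' _ _ hLA hLB n hn
  /- the three expectations as Wilson-measure integrals -/
  have h1 : Ex (fun U => (max CA 1)⁻¹ * A.F (torusLift L (Ψ U)) *
      ((max CB 1)⁻¹ * B.F (torusLift L (Ψ (σ n U))))) =
        ((max CA 1)⁻¹ * (max CB 1)⁻¹) * ∫ V, A.F (torusLift L V) *
          B.F (torusLift L (torusConfigShift (-Pi.single 0 (n : ZMod L)) V)) ∂(wilsonMeasure r.ρ β) := by
    have hfun : (fun U => (max CA 1)⁻¹ * A.F (torusLift L (Ψ U)) *
        ((max CB 1)⁻¹ * B.F (torusLift L (Ψ (σ n U))))) = fun U => (max CA 1)⁻¹ * A.F (torusLift L (Ψ U)) *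
        ((max CB 1)⁻¹ * B.F (torusLift L (torusConfigShift (-Pi.single 0 (n : ZMod L)) (Ψ U)))) := by
      funext U
      rw [hσ]
    have h1' : Ex (fun U => (max CA 1)⁻¹ * A.F (torusLift L (Ψ U)) *
        ((max CB 1)⁻¹ * B.F (torusLift L (torusConfigShift (-Pi.single 0 (n : ZMod L)) (Ψ U))))) =
        ∫ V, (max CA 1)⁻¹ * A.F (torusLift L V) *
          ((max CB 1)⁻¹ * B.F (torusLift L (torusConfigShift (-Pi.single 0 (n : ZMod L)) V)))
            ∂(wilsonMeasure r.ρ β) :=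
      hEx fun V => (max CA 1)⁻¹ * A.F (torusLift L V) *
        ((max CB 1)⁻¹ * B.F (torusLift L (torusConfigShift (-Pi.single 0 (n : ZMod L)) V)))
    rw [hfun, h1', ← integral_const_mul]
    congr 1
    funext V
    ring
  have h2 : Ex (fun U => (max CA 1)⁻¹ * A.F (torusLift L (Ψ U))) =
      (max CA 1)⁻¹ * ∫ V, A.F (torusLift L V) ∂(wilsonMeasure r.ρ β) := by
    rw [← integral_const_mul]
    exact hEx fun V => (max CA 1)⁻¹ * A.F (torusLift L V)
  have h3 : Ex (fun U => (max CB 1)⁻¹ * B.F (torusLift L (Ψ (σ n U)))) =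
      (max CB 1)⁻¹ * ∫ V, B.F (torusLift L V) ∂(wilsonMeasure r.ρ β) := by
    have hfun : (fun U => (max CB 1)⁻¹ * B.F (torusLift L (Ψ (σ n U)))) =
        fun U => (max CB 1)⁻¹ *
          B.F (torusLift L (torusConfigShift (-Pi.single 0 (n : ZMod L)) (Ψ U))) := by
      funext U
      rw [hσ]
    have h3' : Ex (fun U => (max CB 1)⁻¹ *
        B.F (torusLift L (torusConfigShift (-Pi.single 0 (n : ZMod L)) (Ψ U)))) =
        ∫ V, (max CB 1)⁻¹ * B.F (torusLift L (torusConfigShift (-Pi.single 0 (n : ZMod L)) V))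
          ∂(wilsonMeasure r.ρ β) :=
      hEx fun V => (max CB 1)⁻¹ * B.F (torusLift L (torusConfigShift (-Pi.single 0 (n : ZMod L)) V))
    rw [hfun, h3', ← integral_const_mul]
    exact wilsonExpectation_comp_torusConfigShift r.ρ β (-Pi.single 0 (n : ZMod L))
      fun V => (max CB 1)⁻¹ * B.F (torusLift L V)
  /- the connected correlation in the same terms -/
  have hproj : Literature.Probability.LatticeModels.Torus.proj L
      (-Pi.single 0 (n : ℤ) : Literature.Probability.LatticeModels.Site 4) =
        -Pi.single (0 : Fin 4) (n : ZMod L) := by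
    funext i
    simp [Literature.Probability.LatticeModels.Torus.proj_apply, Pi.single_apply]
  have hcorr : latticeConnectedCorr r.ρ β L A.F B.F n =
      (∫ V, A.F (torusLift L V) *
          B.F (torusLift L (torusConfigShift (-Pi.single 0 (n : ZMod L)) V)) ∂(wilsonMeasure r.ρ β)) -
        (∫ V, A.F (torusLift L V) ∂(wilsonMeasure r.ρ β)) *
          ∫ V, B.F (torusLift L V) ∂(wilsonMeasure r.ρ β) := by
    have hB : ∀ V : GaugeConfig 4 L G,
        B.F (configShift (-Pi.single 0 (n : ℤ)) (torusLift L V)) =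
          B.F (torusLift L (torusConfigShift (-Pi.single 0 (n : ZMod L)) V)) := by
      intro V
      have h := congrFun (toTorusObservable_comp_configShift (G := G) L
        (-Pi.single 0 (n : ℤ)) B.F) V
      simp only [Function.comp_apply, toTorusObservable_apply, hproj] at h
      exact h
    simp only [latticeConnectedCorr, hB]
  /- conclusion -/
  rw [h1, h2, h3] at main
  have hid : (max CA 1)⁻¹ * (max CB 1)⁻¹ * (∫ V, A.F (torusLift L V) *
      B.F (torusLift L (torusConfigShift (-Pi.single 0 (n : ZMod L)) V)) ∂(wilsonMeasure r.ρ β)) -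
        (max CA 1)⁻¹ * (∫ V, A.F (torusLift L V) ∂(wilsonMeasure r.ρ β)) *
          ((max CB 1)⁻¹ * ∫ V, B.F (torusLift L V) ∂(wilsonMeasure r.ρ β)) =
      ((max CA 1)⁻¹ * (max CB 1)⁻¹) * latticeConnectedCorr r.ρ β L A.F B.F n := by
    rw [hcorr]
    ring
  rw [hid, abs_mul, abs_of_pos (by positivity)] at main
  calc |latticeConnectedCorr r.ρ β L A.F B.F n|
      = (max CA 1 * max CB 1) *
          ((max CA 1)⁻¹ * (max CB 1)⁻¹ * |latticeConnectedCorr r.ρ β L A.F B.F n|) := by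
        field_simp
    _ ≤ (max CA 1 * max CB 1) * (C * Real.exp (-(m * n))) :=
        mul_le_mul_of_nonneg_left main (by positivity)
    _ = max CA 1 * max CB 1 * C * Real.exp (-(m * n)) := by ring


/-- **EndpointTransfer** (item stmt-QuantumFields-11145 of route `SmallCircleAnchor`, the glue):
volume-uniform spatial clustering of bounded local observables for the undeformed Wilson theory on
the symmetric torus `ℤ_L × (ℤ/L)³` (inline finite-temperature vocabulary, `s = 0` endpoint of Leg B)
for all `β ≥ β₁` implies the `latticeConnectedCorr` clustering of `UniformLatticeGap` for `r`, with
`β₀ = β₁`, the same rate `m(β)` and `S₁ = 0` (`n ≤ S ⇒ 2n < 2S + 1`). [folklore] -/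
theorem endpointTransfer_proof :
    Summit.QuantumFields.YangMills.Theses.SmallCircleAnchor.EndpointTransfer := by
  intro G _ _ _ _ _ r h
  letI : MeasurableSpace G := borel G
  haveI : BorelSpace G := ⟨rfl⟩
  obtain ⟨β₁, hβ₁⟩ := h
  refine ⟨β₁, fun β hβ => ?_⟩
  obtain ⟨m, hm, hw⟩ := hβ₁ β hβ
  refine ⟨m, hm, 0, fun A B => ?_⟩
  obtain ⟨C, hC⟩ := endpointTransfer_core r β m hw A B
  exact ⟨C, fun S n _ hn => hC (2 * S + 1) n (by omega)⟩

end Summit.QuantumFields.YangMills.Theorems.SmallCircleAnchor
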